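import Mathlib
import HarnessLib
import Summits.CriticalPhenomena.PercolationContinuityZ3.Theses.PercPotemkinWeaver

/-!
# Line `x2-dense-gluing-coarse-graining` — birth skeleton of `DenseGiantHalfSpace`
(X₂ of the split of `FKGHalfSpaceRigidity`; item `stmt-CriticalPhenomena-18903`, route `PercPotemkinWeaver`)

`DenseGiantHalfSpace` ("monolithic FKG giants percolate in half-spaces") ⟸ the Antal–Pisztora
architecture transplanted from Bernoulli to the associated soft portrait, as two stubs and a proved
composition:

* `stub_densePieceUniqueness` — GLUING: under the soft portrait + monolithicity, for every `δ₁ > 0` the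
  probability that `Λ_n` contains two δ₁-dense box-clusters NOT joined inside `Λ_n` tends to `0`
  (two disjoint dense pieces need a closed membrane of `≍ n²` edges wetted by open mass on both sides —
  an increasing × decreasing pattern that positive association penalises; Bernoulli `p > p_c`: known);
* `stub_halfSpaceCoarseGraining` — COARSE GRAINING WITHOUT INDEPENDENCE: monolithic + dense-piece
  uniqueness ⇒ NOT a.s. all half-space pieces finite (blocks of side `n` inside the half-space are good
  with probability `→ 1` and good neighbours glue through the shared dense piece; what replaces
  Liggett–Schonmann–Stacey domination for a merely associated, finite-energy, totally ergodic block field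
  is the content — an FKG mosaic would strike here);
* `DenseGiantHalfSpace_of` — PROVED composition.
-/

namespace Summit.CriticalPhenomena.PercolationContinuityZ3.Cruxes.DenseGiantHalfSpace.DenseGluingCoarseGraining

open MeasureTheory
open Summit.CriticalPhenomena.PercolationContinuityZ3.Theses.PercPotemkinWeaver (DenseGiantHalfSpace)

/-- STUB 1 statement (dense-piece uniqueness): under the hypotheses of X₂, for every `δ₁ > 0` the
probability that `Λ_n` contains two δ₁-dense box-clusters not joined inside `Λ_n` tends to `0`. -/
def DensePieceUniqueness : Prop :=
  ∀ μ : MeasureTheory.Measure (Literature.Probability.Percolation.BondConfig (Literature.Probability.LatticeModels.Site 3)), MeasureTheory.IsProbabilityMeasure μ → (∀ᵐ ω ∂μ, ω ⊆ (Literature.Probability.LatticeModels.zdGraph 3).edgeSet) → (∀ (v : Literature.Probability.LatticeModels.Site 3) (S : Set (Literature.Probability.Percolation.BondConfig (Literature.Probability.LatticeModels.Site 3))), MeasurableSet S → μ (Literature.Probability.Percolation.BondConfig.relabel (Literature.Probability.Percolation.sym2Equiv (Literature.Probability.LatticeModels.Site.shift v)) ⁻¹' S) = μ S) → (∀ S :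 Set (Literature.Probability.Percolation.BondConfig (Literature.Probability.LatticeModels.Site 3)), MeasurableSet S → (∀ v : Literature.Probability.LatticeModels.Site 3, Literature.Probability.Percolation.BondConfig.relabel (Literature.Probability.Percolation.sym2Equiv (Literature.Probability.LatticeModels.Site.shift v)) ⁻¹' S = S) → μ S = 0 ∨ μ S = 1) → (∀ N : ℕ, ∃ c : ℝ, 0 < c ∧ ∀ S : Set (Literature.Probability.Percolation.BondConfig (Literature.Probability.LatticeModels.Site 3)), MeasurableSet S → c * μ.real ((fun ω : Literature.Probability.Percolation.BondConfig (Literature.Probability.LatticeModels.Site 3) => ω ∪ ↑(Literature.Probability.LatticeModels.edgesIn (Literature.Probability.LatticeModels.zdGraph 3) (Literature.Probability.LatticeModels.box 3 N))) ⁻¹' S) ≤ μ.real S) → (∀ N : ℕ, ∃ c : ℝ, 0 < c ∧ ∀ S : Set (Literature.Probability.Percolation.BondConfig (Literature.Probability.LatticeModels.Site 3)), MeasurableSet S → c * μ.real ((fun ω : Literature.Probability.Percolation.BondConfig (Literature.Probability.LatticeModels.Site 3) => ω \ ↑(Literature.Probability.LatticeModels.edgesIn (Literature.Probability.LatticeModels.zdGraph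 3) (Literature.Probability.LatticeModels.box 3 N))) ⁻¹' S) ≤ μ.real S) → (∀ v : Literature.Probability.LatticeModels.Site 3, v ≠ 0 → Ergodic (Literature.Probability.Percolation.BondConfig.relabel (Literature.Probability.Percolation.sym2Equiv (Literature.Probability.LatticeModels.Site.shift v))) μ) → (∀ (γ : Literature.Probability.LatticeModels.zdGraph 3 ≃g Literature.Probability.LatticeModels.zdGraph 3) (A : Set (Literature.Probability.Percolation.BondConfig (Literature.Probability.LatticeModels.Site 3))), MeasurableSet A → μ (Literature.Probability.Percolation.BondConfig.relabel (Literature.Probability.Percolation.sym2Equiv γ.toEquiv) ⁻¹' A) = μ A) → (∀ A B : Set (Literature.Probability.Percolation.BondConfig (Literature.Probability.LatticeModels.Site 3)), IsUpperSet A → IsUpperSet B → MeasurableSet A → MeasurableSet B → μ A * μ B ≤ μ (A ∩ B)) → 0 < μ.real (Literature.Probability.Percolation.percolatesAt (0 : Literature.Probability.LatticeModels.Site 3)) → (∀ᵐ ω ∂μ, Literature.Probability.Percolation.numInfiniteClusters ω = 1) → (∃ δ : ℝ, 0 < δ ∧ ∀ η : ℝ, 0 < η → ∃ N : ℕ, ∀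 n : ℕ, N ≤ n → 1 - η ≤ μ.real {ω | ∃ x ∈ Literature.Probability.LatticeModels.box 3 n, δ * ((Literature.Probability.LatticeModels.box 3 n).card : ℝ) ≤ (({y : Literature.Probability.LatticeModels.Site 3 | ω ∈ Literature.Probability.Percolation.openConnIn (↑(Literature.Probability.LatticeModels.box 3 n) : Set (Literature.Probability.LatticeModels.Site 3)) x y}).ncard : ℝ)}) → ∀ δ₁ : ℝ, 0 < δ₁ → ∀ η : ℝ, 0 < η → ∃ N : ℕ, ∀ n : ℕ, N ≤ n → μ.real {ω | ∃ x ∈ Literature.Probability.LatticeModels.box 3 n, ∃ x' ∈ Literature.Probability.LatticeModels.box 3 n, ω ∉ Literature.Probability.Percolation.openConnIn (↑(Literature.Probability.LatticeModels.box 3 n) : Set (Literature.Probability.LatticeModels.Site 3)) x x' ∧ δ₁ * ((Literature.Probability.LatticeModels.box 3 n).card : ℝ) ≤ (({y : Literature.Probability.LatticeModels.Site 3 | ω ∈ Literature.Probability.Percolation.openConnIn (↑(Literature.Probability.LatticeModels.box 3 n) : Set (Literature.Probability.LatticeModels.Site 3)) x y}).ncard : ℝ) ∧ δ₁ * ((Literature.Probability.LatticeModels.box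 3 n).card : ℝ) ≤ (({y : Literature.Probability.LatticeModels.Site 3 | ω ∈ Literature.Probability.Percolation.openConnIn (↑(Literature.Probability.LatticeModels.box 3 n) : Set (Literature.Probability.LatticeModels.Site 3)) x' y}).ncard : ℝ)} ≤ η

/-- STUB 2 statement (half-space coarse graining without independence): the hypotheses of X₂ plus
dense-piece uniqueness exclude a.s. finiteness of all half-space pieces. -/
def HalfSpaceCoarseGraining : Prop :=
  ∀ μ : MeasureTheory.Measure (Literature.Probability.Percolation.BondConfig (Literature.Probability.LatticeModels.Site 3)), MeasureTheory.IsProbabilityMeasure μ → (∀ᵐ ω ∂μ, ω ⊆ (Literature.Probability.LatticeModels.zdGraph 3).edgeSet) → (∀ (v : Literature.Probability.LatticeModels.Site 3) (S : Set (Literature.Probability.Percolation.BondConfig (Literature.Probability.LatticeModels.Site 3))), MeasurableSet S → μ (Literature.Probability.Percolation.BondConfig.relabel (Literature.Probability.Percolation.sym2Equiv (Literature.Probability.LatticeModels.Site.shift v)) ⁻¹' S) = μ S) → (∀ S : Set (Literature.Probability.Percolation.BondConfig (Literature.Probability.LatticeModels.Site 3)), MeasurableSet S → (∀ v : Literature.Probability.LatticeModels.Site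 3, Literature.Probability.Percolation.BondConfig.relabel (Literature.Probability.Percolation.sym2Equiv (Literature.Probability.LatticeModels.Site.shift v)) ⁻¹' S = S) → μ S = 0 ∨ μ S = 1) → (∀ N : ℕ, ∃ c : ℝ, 0 < c ∧ ∀ S : Set (Literature.Probability.Percolation.BondConfig (Literature.Probability.LatticeModels.Site 3)), MeasurableSet S → c * μ.real ((fun ω : Literature.Probability.Percolation.BondConfig (Literature.Probability.LatticeModels.Site 3) => ω ∪ ↑(Literature.Probability.LatticeModels.edgesIn (Literature.Probability.LatticeModels.zdGraph 3) (Literature.Probability.LatticeModels.box 3 N))) ⁻¹' S) ≤ μ.real S) → (∀ N : ℕ, ∃ c : ℝ, 0 < c ∧ ∀ S : Set (Literature.Probability.Percolation.BondConfig (Literature.Probability.LatticeModels.Site 3)), MeasurableSet S → c * μ.real ((fun ω : Literature.Probability.Percolation.BondConfig (Literature.Probability.LatticeModels.Site 3) => ω \ ↑(Literature.Probability.LatticeModels.edgesIn (Literature.Probability.LatticeModels.zdGraph 3) (Literature.Probability.LatticeModels.box 3 N))) ⁻¹' S) ≤ μ.real S) → (∀ v : Literature.Probability.LatticeModels.Site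 3, v ≠ 0 → Ergodic (Literature.Probability.Percolation.BondConfig.relabel (Literature.Probability.Percolation.sym2Equiv (Literature.Probability.LatticeModels.Site.shift v))) μ) → (∀ (γ : Literature.Probability.LatticeModels.zdGraph 3 ≃g Literature.Probability.LatticeModels.zdGraph 3) (A : Set (Literature.Probability.Percolation.BondConfig (Literature.Probability.LatticeModels.Site 3))), MeasurableSet A → μ (Literature.Probability.Percolation.BondConfig.relabel (Literature.Probability.Percolation.sym2Equiv γ.toEquiv) ⁻¹' A) = μ A) → (∀ A B : Set (Literature.Probability.Percolation.BondConfig (Literature.Probability.LatticeModels.Site 3)), IsUpperSet A → IsUpperSet B → MeasurableSet A → MeasurableSet B → μ A * μ B ≤ μ (A ∩ B)) → 0 < μ.real (Literature.Probability.Percolation.percolatesAt (0 : Literature.Probability.LatticeModels.Site 3)) → (∀ᵐ ω ∂μ, Literature.Probability.Percolation.numInfiniteClusters ω = 1) → (∃ δ : ℝ, 0 < δ ∧ ∀ η : ℝ, 0 < η → ∃ N : ℕ, ∀ n : ℕ, N ≤ n → 1 - η ≤ μ.real {ω | ∃ x ∈ Literature.Probability.LatticeModels.box 3 n, δ * ((Literature.Probability.LatticeModels.box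 3 n).card : ℝ) ≤ (({y : Literature.Probability.LatticeModels.Site 3 | ω ∈ Literature.Probability.Percolation.openConnIn (↑(Literature.Probability.LatticeModels.box 3 n) : Set (Literature.Probability.LatticeModels.Site 3)) x y}).ncard : ℝ)}) → (∀ δ₁ : ℝ, 0 < δ₁ → ∀ η : ℝ, 0 < η → ∃ N : ℕ, ∀ n : ℕ, N ≤ n → μ.real {ω | ∃ x ∈ Literature.Probability.LatticeModels.box 3 n, ∃ x' ∈ Literature.Probability.LatticeModels.box 3 n, ω ∉ Literature.Probability.Percolation.openConnIn (↑(Literature.Probability.LatticeModels.box 3 n) : Set (Literature.Probability.LatticeModels.Site 3)) x x' ∧ δ₁ * ((Literature.Probability.LatticeModels.box 3 n).card : ℝ) ≤ (({y : Literature.Probability.LatticeModels.Site 3 | ω ∈ Literature.Probability.Percolation.openConnIn (↑(Literature.Probability.LatticeModels.box 3 n) : Set (Literature.Probability.LatticeModels.Site 3)) x y}).ncard : ℝ) ∧ δ₁ * ((Literature.Probability.LatticeModels.box 3 n).card : ℝ) ≤ (({y : Literature.Probability.LatticeModels.Site 3 | ω ∈ Literature.Probability.Percolation.openConnIn (↑(Literature.Probability.LatticeModels.box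 3 n) : Set (Literature.Probability.LatticeModels.Site 3)) x' y}).ncard : ℝ)} ≤ η) → ¬ (∀ᵐ ω ∂μ, ∀ (i : Fin 3) (a : ℤ) (v : Literature.Probability.LatticeModels.Site 3), {y : Literature.Probability.LatticeModels.Site 3 | ω ∈ Literature.Probability.Percolation.openConnIn {x : Literature.Probability.LatticeModels.Site 3 | a ≤ x i} v y}.Finite ∧ {y : Literature.Probability.LatticeModels.Site 3 | ω ∈ Literature.Probability.Percolation.openConnIn {x : Literature.Probability.LatticeModels.Site 3 | x i ≤ a} v y}.Finite)

/-- **Stub 1 — dense-piece uniqueness (FKG gluing).** Under the soft portrait with `θ > 0`, a unique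
infinite cluster and monolithicity, for every `δ₁ > 0`: P(`Λ_n` contains two δ₁-dense box-clusters not
joined inside `Λ_n`) `→ 0`. -/
theorem stub_densePieceUniqueness : DensePieceUniqueness := by
  sorry

/-- **Stub 2 — half-space coarse graining without independence.** Under the soft portrait with `θ > 0`,
a unique infinite cluster, monolithicity AND dense-piece uniqueness, it is not the case that a.s. every
cluster of every coordinate half-space is finite. -/
theorem stub_halfSpaceCoarseGraining : HalfSpaceCoarseGraining := by
  sorry

namespace Registered
/-- registered stub signature -/
abbrev stub_densePieceUniqueness : Prop := DensePieceUniqueness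
/-- registered stub signature -/
abbrev stub_halfSpaceCoarseGraining : Prop := HalfSpaceCoarseGraining
end Registered

/-- **Composition**: `stub_densePieceUniqueness → stub_halfSpaceCoarseGraining → DenseGiantHalfSpace`. -/
theorem DenseGiantHalfSpace_of (h₁ : Registered.stub_densePieceUniqueness)
    (h₂ : Registered.stub_halfSpaceCoarseGraining) : DenseGiantHalfSpace := by
  intro μ hμ hsupp hshift hzo hins hdel herg haut hfkg hθ hU hD
  exact h₂ μ hμ hsupp hshift hzo hins hdel herg haut hfkg hθ hU hD
    (h₁ μ hμ hsupp hshift hzo hins hdel herg haut hfkg hθ hU hD)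

end Summit.CriticalPhenomena.PercolationContinuityZ3.Cruxes.DenseGiantHalfSpace.DenseGluingCoarseGraining
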